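import Literature.MathematicalPhysics.QuantumFieldTheory.Balaban1983to89.Node00.CarriersB12Datum

/-!
# NODE 00 (YM-PLAN Track A) — STAGE 3′(X.B12) COMPANION, MODULE F: THE DATUM-SIZE LAWS OF MODULE D AT A PRESENTED RUN IN TWO REGIONS —
# `A = A·1_R + A·1_{Rᶜ}`, `B = Q(ηA·1_R) + Q(ηA·1_{Rᶜ})`, `𝔄 = 𝔄_near + 𝔄_far` (linearity of `Q` and `H_{1,j}`); the NEAR part bounded from (3.31) «on □₀» and the
# (3.27)-type sup law for `h` ON `R` ONLY (`R` = the bonds of `□̃⁴`: (3.27) «on □̃⁴» AS PRINTED) through (3.32)₁ (module E's `norm_scrA_apply_lt_of_mem` = r20's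
# `ineq332_sup_bond` BY NAME); the FAR part `𝔄_far = H_{1,j}Q(ηA·1_{□₀∖R})` carried as ONE DISPLAYED remainder `‖𝔄_far‖ ≤ ρ`; module D's `ChartB12Laws.dat_lt ∕ dat_lin_lt`
# DERIVED from these (`chartB12Laws_withDatum_of_region`, `chartB12Laws_withDatum_box4`); module E's law = the case `R = □₀`, `ρ = 0` (`datFar_box0_eq_zero`)

NODE 00 COMPANION MODULE (seat `pub-ymgap-node00-def-B12` g6, 2026-08-27; HUMAN RULING D-0062; director-ym R141 (A)).  OCCASION: the two referee reads of module E
(dag-ref-G READ59, dag-ref-C READ-161: PASS, not a discharge) carry one READER NOTE (R-B12-E3): module E displays its (3.27)-type law `|h(𝐔)(b)| < α′` on ALL bonds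
of `□₀ = □̃⁵`, whereas print states (3.27) «on □̃⁴» — «fold the □̃⁵-vs-□̃⁴ sentence into the next load-bearing edit».  This file is that edit, APPEND-ONLY (D-0064): a NEW
importing module; module E is untouched and CONSUMED BY NAME (`DatumB12Pres.scrA ∕ fldB ∕ scrA_apply_of_not_mem ∕ norm_scrA_apply_lt_of_mem`, `ChartB12Run.withDatum ∕
dat_withDatum`, `A331Of`, `IdxB12.regionT`); also by name: module D (`ChartB12Run.dat ∕ lin`, `ChartB12Laws`; `Node00/CarriersB12Chart`), g32 (`IdxB12.boxT_mono`;
`Node00/CarriersB12FundamentalCase`), def-T (`Sect2.regionOfSet_bonds_mono ∕ _dpairs_mono`; `Node00/Sect2RegionGeometry`), Mathlib (`Set.indicator`, operator norms).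

PRINT.  [I] = Bałaban, *Renormalization group approach to lattice gauge field theories. I*, CMP **109** (1987), §3 (held text `paper:balaban1987-cmp109-rg-i-small-field`,
journal page = PDF page + 248); [12] = Bałaban, *Averaging operations for lattice gauge theories*, CMP **98** (1985); [15] = Bałaban, *The variational problem …*, CMP **102**
(1985).  p. 273: *«We take the function U_j constructed for the cube □₀ = □̃⁵ … Thus we construct a sequence of cubes {□ₙ}, n = 0, 1, …, k + 1, satisfying the conditions
(1.3)–(1.6) [14] …, hence □̃⁴ ⊂ □_{k+1}»*.  p. 275 (3.27): *«U_{k+1}(□₀, V)^{u_{k+1}} = exp(iL⁻¹η𝐇_{k+1}(□₀, (1/i) log V)), |𝐇_{k+1}(□₀, (1/i) log V)|, |∇^{L⁻¹η}𝐇_{k+1}(…)|,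
‖𝐇_{k+1}(…)‖_{1,β} < B₃O(1)Mα₀ on □̃⁴, for 0 ≤ β ≤ β₀,  |u_{k+1} − 1| < B₃O(1)Mα₀ on □₀»*.  p. 276 (3.30): *«A = (1/iη) log [exp iη𝐀 · exp iL⁻¹η𝐇_{k+1}(□₀, (1/i) log V)],
B = Q(ηA) on □₀ … The function B above is defined on the set of bonds determining U_j(□₀), i.e. on ⋃ₙ(…)»*; (3.31) *«|𝐀|, |∇^η𝐀|, ‖𝐀‖_{1,β} < α₂ on □₀ … We have similar
bounds for the function 𝐇_{k+1}(□₀, (1/i) log V), with α₂ replaced by B₃O(1)Mα₀, and □₀ by □̃⁴, see (3.27)»*.  p. 277 (3.32): *«|A|, |∇^ηA|, ‖A‖_{1,β} < 2(α₂ + B₃O(1)Mα₀)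
on □̃⁴ … By the definition of B and by the inequalities (3.32) we have |B| < O(1)L^jη»*.

WHAT THIS FILE DOES (kernel bookkeeping; the mathematics is [I]'s and r20's).
§1 `IdxB12.regionT_bonds_mono ∕ regionT_dpairs_mono` («on □̃ᵐ» ⊆ «on □̃ⁿ» for `m ≤ n`, g32's `IdxB12.boxT_mono` + def-T's `Sect2.regionOfSet_bonds_mono` BY NAME;
   `regionT_four_bonds_subset`: the bonds of `□̃⁴` are bonds of `□₀`); for a set of bonds `R`: `scrA_eq_indicator_add` (`A = A·1_R + A·1_{Rᶜ}`), **`fldB_eq_near_add_far`** (`B = Q(ηA·1_R) + Q(ηA·1_{Rᶜ})`, `Q` linear),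
   `indicator_compl_scrA_eq_zero_of_subset` (`A·1_{Rᶜ} = 0` once `R` contains the bonds of `□₀`: `A = 0` off `□₀`, module E's (R-E1)), **`norm_indicator_scrA_le`** —
   `|A·1_R| ≤ 2(α₂ + α′)` from (3.31)'s sup member ON `□₀` (it covers `R ∩ □₀`; off `□₀` `A = 0`) and the (3.27)-type law `|h(𝐔)(b)| < α′` for the bonds `b ∈ R` ONLY, with
   `η(α₂ + α′) ≤ 1/8` ((3.32)₁ bondwise, module E BY NAME), and `norm_Q_near_le` (`|Q(ηA·1_R)| ≤ ‖Q‖·η·2(α₂ + α′)`).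
§2 at module E's presented run `χ.withDatum δ`: `datNear ∕ datFar` (`𝔄_near = H_{1,j}Q(ηA·1_R)`, `𝔄_far = H_{1,j}Q(ηA·1_{Rᶜ})`), `dat_withDatum_eq_datNear_add_datFar`
   (`𝔄 = 𝔄_near + 𝔄_far`), `datFar_eq_zero_of_box0_subset ∕ datFar_box0_eq_zero` (at `R ⊇ □₀`-bonds the far part vanishes), `norm_datNear_le`,
   **`norm_dat_withDatum_le_of_region`** (`‖𝔄‖ ≤ ‖H_{1,j}‖·‖Q‖·η·2(α₂ + α′) + ρ` given `‖𝔄_far‖ ≤ ρ`), **`dat_lt_withDatum_of_region ∕ dat_lin_lt_withDatum_of_region`** —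
   module D's `ChartB12Laws.dat_lt ∕ dat_lin_lt` field types VERBATIM from: the (3.27)-type law displayed for `(𝐔, 𝐉)` in the (3.40)-space of record and `b ∈ R`, the far
   remainder displayed for such `(𝐔, 𝐉)` and `𝐀 ∈ (3.31)`, `η(α₂ + α′) ≤ 1/8`, and the arithmetic `‖H_{1,j}‖·‖Q‖·η·2(α₂ + α′) + ρ < a` (resp. `‖H_{1,j}‖·(… + α₃) + ρ < a`);
   **`chartB12Laws_withDatum_of_region`** (module D's fifteen laws: module E's thirteen datum-free binders + the two), **`chartB12Laws_withDatum_box4`** (`R :=` the bonds of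
   `□̃⁴`: the law for `h` exactly where (3.27) prints it), and `datFar_norm_le_zero_box0` (at `R = □₀` the remainder display holds with `ρ = 0`: module E's
   `chartB12Laws_withDatum` is the case `R = □₀`, `ρ = 0` of this file's).

LOCATED READINGS (said, not adjudicated).  (R-F1) (3.27) has two lines: the potentials (sup, gradient, Hölder) «on □̃⁴» and the gauge transformation «|u_{k+1} − 1| … on
□₀»; the sup law for `h = L⁻¹𝐇_{k+1}(□₀, ·)` on `□₀ ∖ □̃⁴` is NOT printed, and `B` is defined on «the set of bonds determining U_j(□₀)» (p. 276), not on a □̃⁴-stencil — so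
neither «(3.27) on □̃⁵» nor «Q charges the □̃⁴-bonds only» is print.  (R-F2) Print derives «|B| < O(1)L^jη» from (3.32) «on □̃⁴»; the contribution of `A` off `□̃⁴` to the
datum `𝔄 = H_{1,j}B` used on `Y = □̃³` sits inside print's «O(1)» (the locality of the averaging `Q_j`, (14) [12], and the decay of `H_{1,j}` off `Y`, [15]) — at NODE 00's
objects, where `Q` and `H_{1,j} = lin` are presentation data without kernels, it is the DISPLAYED remainder `‖𝔄_far‖ ≤ ρ` with `ρ` free; this file isolates that one
unprinted step instead of hiding it in a law for `h` on all of `□₀`.  (R-F3) The near bound needs only (3.32)'s first member; the gradient and Hölder members of (3.27) ∕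
(3.32) are not used by the datum-size laws (module E (R-E4)).

HONEST FRAMING (binding).  OBJECTS + kernel bookkeeping.  `h(𝐔)`, `Q`, `H_{1,j}` are DATA with no construction here; the (3.27)-type law on `R`, the far remainder, the
smallness `η(α₂ + α′) ≤ 1/8`, the constant arithmetic and module D's thirteen datum-free laws are DISPLAYED hypotheses of their consumers; NO bound on `ρ` is claimed;
nothing of [I] ∕ [12] ∕ [15] is asserted; the theorems are elementary consequences of the cited tree lemmas (linearity, `Set.indicator`, norm algebra).  N09 is NOT
discharged by this file; R4's instance count is untouched; count-neutral.  One finite T⁴ programme at fixed ε, Bałaban as printed — NOT continuum ∕ ℝ⁴ ∕ infinite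
volume ∕ OS ∕ mass gap ∕ Clay.  No `sorry`, no `axiom`, no `opaque`, no `instance`, no `notation`.
-/

noncomputable section

namespace Literature.MathematicalPhysics.QuantumFieldTheory.Balaban1983to89.Node00

open B12RegularSpaces111 (Region space grad)
open B12RegularSpaces111SpecialUnitary (suModel)
open B11Eq174Chart (Regime)
open scoped Matrix.Norms.L2Operator

/-! ## §1. «on □̃ᵐ» ⊆ «on □̃ⁿ»; near ∕ far: `A = A·1_R + A·1_{Rᶜ}`, `B = Q(ηA·1_R) + Q(ηA·1_{Rᶜ})`; the near sup bound -/

section NearFar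

variable {P : Params} {N M : ℕ}

namespace IdxB12

/-- The bonds «on □̃ᵐ» are bonds «on □̃ⁿ» for `m ≤ n`. [cite: Balaban1987RG1, p.273 («□₀ = □̃⁵»), (3.27) p.275 («on □̃⁴») (bookkeeping)] -/
theorem regionT_bonds_mono (i : IdxB12 P M) {m n : ℕ} (h : m ≤ n) : (i.regionT m).bonds ⊆ (i.regionT n).bonds :=
  Sect2.regionOfSet_bonds_mono (i.boxT_mono h)

/-- The derivative triples «on □̃ᵐ» are triples «on □̃ⁿ» for `m ≤ n`. [cite: Balaban1987RG1, (3.27) p.275, (3.31) p.276 (bookkeeping)] -/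
theorem regionT_dpairs_mono (i : IdxB12 P M) {m n : ℕ} (h : m ≤ n) : (i.regionT m).dpairs ⊆ (i.regionT n).dpairs :=
  Sect2.regionOfSet_dpairs_mono (i.boxT_mono h)

/-- **The bonds of `□̃⁴` are bonds of `□₀ = □̃⁵`.** [cite: Balaban1987RG1, p.273 («□₀ = □̃⁵»), (3.27) p.275 («on □̃⁴»)] -/
theorem regionT_four_bonds_subset (i : IdxB12 P M) : (i.regionT 4).bonds ⊆ (i.regionT 5).bonds :=
  i.regionT_bonds_mono (by norm_num)

end IdxB12

namespace DatumB12Pres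

variable (δ : DatumB12Pres P N) (i : IdxB12 P M)

/-- `A = A·1_R + A·1_{Rᶜ}` for any set of bonds `R`. [cite: Balaban1987RG1, (3.30) p.276 (bookkeeping)] -/
theorem scrA_eq_indicator_add (R : Set (PBond P 0)) (Φ : FieldPair P 0 (MatA N)ˣ (MatA N)) (A : PBond P 0 → MatA N) :
    δ.scrA i Φ A = R.indicator (δ.scrA i Φ A) + Rᶜ.indicator (δ.scrA i Φ A) :=
  (Set.indicator_self_add_compl R _).symm

/-- **`B = Q(ηA·1_R) + Q(ηA·1_{Rᶜ})`** — the coarse datum of (3.30) split along a set of bonds `R` (linearity of `Q`). [cite: Balaban1987RG1, (3.30) p.276; Balaban1985Averaging, (14) p.19] -/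
theorem fldB_eq_near_add_far (R : Set (PBond P 0)) (Φ : FieldPair P 0 (MatA N)ˣ (MatA N)) (A : PBond P 0 → MatA N) :
    δ.fldB i Φ A = δ.Q (((i.η : ℝ) : ℂ) • R.indicator (δ.scrA i Φ A)) + δ.Q (((i.η : ℝ) : ℂ) • Rᶜ.indicator (δ.scrA i Φ A)) := by
  rw [← map_add, ← smul_add, Set.indicator_self_add_compl]
  rfl

/-- **`A·1_{Rᶜ} = 0` once `R` contains the bonds of `□₀`** (`A = 0` off `□₀`, module E's located reading (R-E1)). [cite: Balaban1987RG1, (3.30) p.276 («on □₀»)] -/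
theorem indicator_compl_scrA_eq_zero_of_subset {R : Set (PBond P 0)} (hR : (i.regionT 5).bonds ⊆ R) (Φ : FieldPair P 0 (MatA N)ˣ (MatA N))
    (A : PBond P 0 → MatA N) : Rᶜ.indicator (δ.scrA i Φ A) = 0 := by
  funext b
  by_cases hbR : b ∈ R
  · have hbc : b ∉ Rᶜ := by simpa using hbR
    exact Set.indicator_of_notMem hbc _
  · rw [Set.indicator_of_mem (Set.mem_compl hbR)]
    exact δ.scrA_apply_of_not_mem i Φ A (fun hb => hbR (hR hb))

/-- **The near sup bound `|A·1_R| ≤ 2(α₂ + α′)`** from (3.31)'s sup member `|𝐀(b)| < α₂` on the bonds of `□₀` and the (3.27)-type law `|h(𝐔)(b)| < α′` for the bonds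
`b ∈ R` ONLY (`R` = the bonds of `□̃⁴`: (3.27) as printed), with `η(α₂ + α′) ≤ 1/8` — (3.32), first member, bondwise on `R ∩ □₀` (module E's `norm_scrA_apply_lt_of_mem` =
r20's `ineq332_sup_bond` BY NAME); on `R ∖ □₀` and off `R` the function vanishes. [cite: Balaban1987RG1, (3.27) p.275 («on □̃⁴»), (3.31) p.276, (3.32) p.277 («on □̃⁴»)] -/
theorem norm_indicator_scrA_le (hη : 0 < i.η) {α₂ α' : ℝ} (h0 : 0 ≤ α₂ + α') (R : Set (PBond P 0)) (Φ : FieldPair P 0 (MatA N)ˣ (MatA N))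
    (A : PBond P 0 → MatA N) (hA : ∀ b ∈ (i.regionT 5).bonds, ‖A b‖ < α₂) (hh : ∀ b ∈ R, ‖δ.hBox Φ b‖ < α') (hsmall : i.η * (α₂ + α') ≤ 1 / 8) :
    ‖R.indicator (δ.scrA i Φ A)‖ ≤ 2 * (α₂ + α') := by
  refine (pi_norm_le_iff_of_nonneg (by positivity)).2 fun b => ?_
  by_cases hbR : b ∈ R
  · rw [Set.indicator_of_mem hbR]
    by_cases hb : b ∈ (i.regionT 5).bonds
    · exact (δ.norm_scrA_apply_lt_of_mem i hη Φ A hb (hA b hb) (hh b hbR) hsmall).le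
    · rw [δ.scrA_apply_of_not_mem i Φ A hb, norm_zero]
      positivity
  · rw [Set.indicator_of_notMem hbR, norm_zero]
    positivity

/-- **`|Q(ηA·1_R)| ≤ ‖Q‖·η·2(α₂ + α′)`** — the near part of «|B| < O(1)L^jη» in kernel form. [cite: Balaban1987RG1, p.277 («by the inequalities (3.32) we have |B| < O(1)L^jη»)] -/
theorem norm_Q_near_le (hη : 0 < i.η) {α₂ α' : ℝ} (h0 : 0 ≤ α₂ + α') (R : Set (PBond P 0)) (Φ : FieldPair P 0 (MatA N)ˣ (MatA N))
    (A : PBond P 0 → MatA N) (hA : ∀ b ∈ (i.regionT 5).bonds, ‖A b‖ < α₂) (hh : ∀ b ∈ R, ‖δ.hBox Φ b‖ < α') (hsmall : i.η * (α₂ + α') ≤ 1 / 8) :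
    ‖δ.Q (((i.η : ℝ) : ℂ) • R.indicator (δ.scrA i Φ A))‖ ≤ ‖δ.Q‖ * (i.η * (2 * (α₂ + α'))) := by
  have h1 : ‖δ.Q (((i.η : ℝ) : ℂ) • R.indicator (δ.scrA i Φ A))‖ ≤ ‖δ.Q‖ * ‖((i.η : ℝ) : ℂ) • R.indicator (δ.scrA i Φ A)‖ := δ.Q.le_opNorm _
  have h2 : ‖((i.η : ℝ) : ℂ) • R.indicator (δ.scrA i Φ A)‖ = i.η * ‖R.indicator (δ.scrA i Φ A)‖ := by
    rw [norm_smul, Complex.norm_real, Real.norm_of_nonneg hη.le]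
  have h3 := δ.norm_indicator_scrA_le i hη h0 R Φ A hA hh hsmall
  rw [h2] at h1
  calc ‖δ.Q (((i.η : ℝ) : ℂ) • R.indicator (δ.scrA i Φ A))‖ ≤ ‖δ.Q‖ * (i.η * ‖R.indicator (δ.scrA i Φ A)‖) := h1
    _ ≤ ‖δ.Q‖ * (i.η * (2 * (α₂ + α'))) := by gcongr

end DatumB12Pres

end NearFar

/-! ## §2. At the presented run: `𝔄 = 𝔄_near + 𝔄_far`; module D's datum-size laws from the law for `h` on `R` and the displayed far remainder -/

section WithDatumRegion

variable {P : Params} {N M : ℕ} {𝒴 𝒵 : Type} [NormedAddCommGroup 𝒴] [NormedSpace ℂ 𝒴] [NormedAddCommGroup 𝒵] [NormedSpace ℂ 𝒵]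

namespace ChartB12Run

variable (χ : ChartB12Run P N M 𝒴 𝒵) (δ : DatumB12Pres P N)

/-- **`𝔄_near(𝐔, 𝐀) = H_{1,j}Q(ηA·1_R)`** — the part of the datum `𝔄 = H_{1,j}B` reading `A` on the bonds of `R`. [cite: Balaban1987RG1, (3.30) p.276, p.279 («H_{1,j}B»)] -/
def datNear (R : Set (PBond P 0)) (Φ : FieldPair P 0 (MatA N)ˣ (MatA N)) (A : PBond P 0 → MatA N) : 𝒴 :=
  χ.lin (δ.Q (((χ.idx.η : ℝ) : ℂ) • R.indicator (δ.scrA χ.idx Φ A)))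

/-- **`𝔄_far(𝐔, 𝐀) = H_{1,j}Q(ηA·1_{Rᶜ})`** — the part of the datum reading `A` OFF `R` (for `R` = the bonds of `□̃⁴`: the contribution of `A|_{□₀∖□̃⁴}`, print's «O(1)»;
located reading (R-F2)). [cite: Balaban1987RG1, (3.30) p.276 («defined on the set of bonds determining U_j(□₀)»), p.277 («|B| < O(1)L^jη»)] -/
def datFar (R : Set (PBond P 0)) (Φ : FieldPair P 0 (MatA N)ˣ (MatA N)) (A : PBond P 0 → MatA N) : 𝒴 :=
  χ.lin (δ.Q (((χ.idx.η : ℝ) : ℂ) • Rᶜ.indicator (δ.scrA χ.idx Φ A)))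

/-- **`𝔄 = 𝔄_near + 𝔄_far`** at the presented run (linearity of `Q` and `H_{1,j}`). [cite: Balaban1987RG1, (3.30) p.276, p.279 («H_{1,j}B»)] -/
theorem dat_withDatum_eq_datNear_add_datFar (R : Set (PBond P 0)) (Φ : FieldPair P 0 (MatA N)ˣ (MatA N)) (A : PBond P 0 → MatA N) :
    (χ.withDatum δ).dat Φ A = χ.datNear δ R Φ A + χ.datFar δ R Φ A := by
  rw [dat_withDatum, δ.fldB_eq_near_add_far χ.idx R Φ A, map_add]
  rfl

/-- The far part vanishes once `R` contains the bonds of `□₀` (`A = 0` off `□₀`). [cite: Balaban1987RG1, (3.30) p.276 («on □₀»)] -/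
theorem datFar_eq_zero_of_box0_subset {R : Set (PBond P 0)} (hR : (χ.idx.regionT 5).bonds ⊆ R) (Φ : FieldPair P 0 (MatA N)ˣ (MatA N))
    (A : PBond P 0 → MatA N) : χ.datFar δ R Φ A = 0 := by
  simp only [datFar, δ.indicator_compl_scrA_eq_zero_of_subset χ.idx hR Φ A, smul_zero, map_zero]

/-- **At `R = □₀` there is no far part** (module E's law is the case `R = □₀`, `ρ = 0`). [cite: Balaban1987RG1, (3.30) p.276 («on □₀»)] -/
theorem datFar_box0_eq_zero (Φ : FieldPair P 0 (MatA N)ˣ (MatA N)) (A : PBond P 0 → MatA N) :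
    χ.datFar δ (χ.idx.regionT 5).bonds Φ A = 0 :=
  χ.datFar_eq_zero_of_box0_subset δ (fun _ hb => hb) Φ A

/-- At `R = □₀` the far-remainder display holds with `ρ = 0`. [cite: Balaban1987RG1, (3.30) p.276 («on □₀») (bookkeeping)] -/
theorem datFar_norm_le_zero_box0 (Φ : FieldPair P 0 (MatA N)ˣ (MatA N)) (A : PBond P 0 → MatA N) :
    ‖χ.datFar δ (χ.idx.regionT 5).bonds Φ A‖ ≤ 0 := by
  rw [χ.datFar_box0_eq_zero δ Φ A, norm_zero]

/-- **`‖𝔄_near‖ ≤ ‖H_{1,j}‖·‖Q‖·η·2(α₂ + α′)`** from `𝐀 ∈ (3.31)` (sup member on `□₀`), the (3.27)-type law ON `R` and `η(α₂ + α′) ≤ 1/8`.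
[cite: Balaban1987RG1, (3.27) p.275 («on □̃⁴»), (3.31)–(3.32) pp.276–277, p.277 («|B| < O(1)L^jη»)] -/
theorem norm_datNear_le (hη : 0 < χ.idx.η) {α' : ℝ} (h0 : 0 ≤ χ.α₂ + α') (R : Set (PBond P 0)) (Φ : FieldPair P 0 (MatA N)ˣ (MatA N))
    (A : PBond P 0 → MatA N) (hA : A ∈ A331Of N χ.idx χ.α₂ χ.β₀) (hh : ∀ b ∈ R, ‖δ.hBox Φ b‖ < α') (hsmall : χ.idx.η * (χ.α₂ + α') ≤ 1 / 8) :
    ‖χ.datNear δ R Φ A‖ ≤ ‖χ.lin‖ * (‖δ.Q‖ * (χ.idx.η * (2 * (χ.α₂ + α')))) := by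
  have h1 : ‖χ.datNear δ R Φ A‖ ≤ ‖χ.lin‖ * ‖δ.Q (((χ.idx.η : ℝ) : ℂ) • R.indicator (δ.scrA χ.idx Φ A))‖ := χ.lin.le_opNorm _
  have h2 := δ.norm_Q_near_le χ.idx hη h0 R Φ A hA.2.1 hh hsmall
  exact h1.trans (mul_le_mul_of_nonneg_left h2 χ.lin.opNorm_nonneg)

/-- **`‖𝔄(𝐔, 𝐀)‖ ≤ ‖H_{1,j}‖·‖Q‖·η·2(α₂ + α′) + ρ`** at the presented run, from the near bound and the DISPLAYED far remainder `‖𝔄_far‖ ≤ ρ`.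
[cite: Balaban1987RG1, p.277 («|B| < O(1)L^jη»), (3.27) p.275, (3.30)–(3.32) pp.276–277] -/
theorem norm_dat_withDatum_le_of_region (hη : 0 < χ.idx.η) {α' ρ : ℝ} (h0 : 0 ≤ χ.α₂ + α') (R : Set (PBond P 0))
    (Φ : FieldPair P 0 (MatA N)ˣ (MatA N)) (A : PBond P 0 → MatA N) (hA : A ∈ A331Of N χ.idx χ.α₂ χ.β₀) (hh : ∀ b ∈ R, ‖δ.hBox Φ b‖ < α')
    (hsmall : χ.idx.η * (χ.α₂ + α') ≤ 1 / 8) (hfar : ‖χ.datFar δ R Φ A‖ ≤ ρ) :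
    ‖(χ.withDatum δ).dat Φ A‖ ≤ ‖χ.lin‖ * (‖δ.Q‖ * (χ.idx.η * (2 * (χ.α₂ + α')))) + ρ := by
  rw [χ.dat_withDatum_eq_datNear_add_datFar δ R Φ A]
  exact (norm_add_le _ _).trans (add_le_add (χ.norm_datNear_le δ hη h0 R Φ A hA hh hsmall) hfar)

/-- **THE DATUM-SIZE LAW `ChartB12Laws.dat_lt` OF MODULE D, DERIVED for the presented run IN TWO REGIONS**: from the (3.27)-type law `|h(𝐔)(b)| < α′` displayed for
`(𝐔, 𝐉)` in the (3.40)-space of record and the bonds `b ∈ R` (`R` = the bonds of `□̃⁴`: (3.27) as printed), the far remainder `‖𝔄_far(𝐔, 𝐀)‖ ≤ ρ` displayed for such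
`(𝐔, 𝐉)` and `𝐀 ∈ (3.31)` (located reading (R-F2)), `0 < η`, `η(α₂ + α′) ≤ 1/8`, and the arithmetic `‖H_{1,j}‖·‖Q‖·η·2(α₂ + α′) + ρ < a`.
[cite: Balaban1987RG1, p.277 («|B| < O(1)L^jη»), (3.27) p.275 («on □̃⁴»), (3.30)–(3.32) pp.276–277, (3.40) p.278] -/
theorem dat_lt_withDatum_of_region {Rz : Sect2.Residual P (MatA N)} {cB α' ρ : ℝ} (hη : 0 < χ.idx.η) (h0 : 0 ≤ χ.α₂ + α') (R : Set (PBond P 0))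
    (hh : ∀ Φ : FieldPair P 0 (MatA N)ˣ (MatA N),
      Φ ∈ space (suModel N) (χ.toResid.frameBox Rz) (χ.toResid.csBox cB) ((1 + 2 * χ.toResid.consts.β) * χ.toResid.consts.α₀)
          ((1 + 2 * χ.toResid.consts.β) * χ.toResid.consts.α₁) χ.toResid.α₀ →
        ∀ b ∈ R, ‖δ.hBox Φ b‖ < α')
    (hfar : ∀ Φ : FieldPair P 0 (MatA N)ˣ (MatA N),
      Φ ∈ space (suModel N) (χ.toResid.frameBox Rz) (χ.toResid.csBox cB) ((1 + 2 * χ.toResid.consts.β) * χ.toResid.consts.α₀)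
          ((1 + 2 * χ.toResid.consts.β) * χ.toResid.consts.α₁) χ.toResid.α₀ →
        ∀ A : PBond P 0 → MatA N, A ∈ A331Of N χ.idx χ.α₂ χ.β₀ → ‖χ.datFar δ R Φ A‖ ≤ ρ)
    (hsmall : χ.idx.η * (χ.α₂ + α') ≤ 1 / 8) (ha : ‖χ.lin‖ * (‖δ.Q‖ * (χ.idx.η * (2 * (χ.α₂ + α')))) + ρ < χ.a) :
    ∀ (Φ : FieldPair P 0 (MatA N)ˣ (MatA N)) (A : PBond P 0 → MatA N),
      Φ ∈ space (suModel N) ((χ.withDatum δ).toResid.frameBox Rz) ((χ.withDatum δ).toResid.csBox cB)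
          ((1 + 2 * (χ.withDatum δ).toResid.consts.β) * (χ.withDatum δ).toResid.consts.α₀)
          ((1 + 2 * (χ.withDatum δ).toResid.consts.β) * (χ.withDatum δ).toResid.consts.α₁) (χ.withDatum δ).toResid.α₀ →
        A ∈ (χ.withDatum δ).toResid.A331 → ‖(χ.withDatum δ).dat Φ A‖ < (χ.withDatum δ).a := by
  intro Φ A hΦ hA
  have hle := χ.norm_dat_withDatum_le_of_region δ hη h0 R Φ A hA (hh Φ hΦ) hsmall (hfar Φ hΦ A hA)
  exact lt_of_le_of_lt hle ha

/-- **THE DATUM-SIZE LAW `ChartB12Laws.dat_lin_lt` OF MODULE D, DERIVED for the presented run IN TWO REGIONS** — `‖τ𝔄 + H_{1,j}B′‖ < a` on the printed domain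
(`τ ∈ [0, 1]`, `|B′| < α₃`) from the same two displays, `0 < η`, `η(α₂ + α′) ≤ 1/8` and the arithmetic `‖H_{1,j}‖·(‖Q‖·η·2(α₂ + α′) + α₃) + ρ < a`.
[cite: Balaban1987RG1, p.277 («|B| < O(1)L^jη»), pp.279–280 («B′ with values in 𝔤ᶜ, |B′| < α₃»), (3.27) p.275, (3.30)–(3.32) pp.276–277] -/
theorem dat_lin_lt_withDatum_of_region {Rz : Sect2.Residual P (MatA N)} {cB α' ρ : ℝ} (hη : 0 < χ.idx.η) (h0 : 0 ≤ χ.α₂ + α') (R : Set (PBond P 0))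
    (hh : ∀ Φ : FieldPair P 0 (MatA N)ˣ (MatA N),
      Φ ∈ space (suModel N) (χ.toResid.frameBox Rz) (χ.toResid.csBox cB) ((1 + 2 * χ.toResid.consts.β) * χ.toResid.consts.α₀)
          ((1 + 2 * χ.toResid.consts.β) * χ.toResid.consts.α₁) χ.toResid.α₀ →
        ∀ b ∈ R, ‖δ.hBox Φ b‖ < α')
    (hfar : ∀ Φ : FieldPair P 0 (MatA N)ˣ (MatA N),
      Φ ∈ space (suModel N) (χ.toResid.frameBox Rz) (χ.toResid.csBox cB) ((1 + 2 * χ.toResid.consts.β) * χ.toResid.consts.α₀)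
          ((1 + 2 * χ.toResid.consts.β) * χ.toResid.consts.α₁) χ.toResid.α₀ →
        ∀ A : PBond P 0 → MatA N, A ∈ A331Of N χ.idx χ.α₂ χ.β₀ → ‖χ.datFar δ R Φ A‖ ≤ ρ)
    (hsmall : χ.idx.η * (χ.α₂ + α') ≤ 1 / 8) (ha' : ‖χ.lin‖ * (‖δ.Q‖ * (χ.idx.η * (2 * (χ.α₂ + α'))) + χ.α₃) + ρ < χ.a) :
    ∀ (Φ : FieldPair P 0 (MatA N)ˣ (MatA N)) (A : PBond P 0 → MatA N) (τ : ℝ) (B' : PBond P 0 → MatA N),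
      Φ ∈ space (suModel N) ((χ.withDatum δ).toResid.frameBox Rz) ((χ.withDatum δ).toResid.csBox cB)
          ((1 + 2 * (χ.withDatum δ).toResid.consts.β) * (χ.withDatum δ).toResid.consts.α₀)
          ((1 + 2 * (χ.withDatum δ).toResid.consts.β) * (χ.withDatum δ).toResid.consts.α₁) (χ.withDatum δ).toResid.α₀ →
        A ∈ (χ.withDatum δ).toResid.A331 → 0 ≤ τ → τ ≤ 1 → ‖B'‖ < (χ.withDatum δ).toResid.consts.α₃ →
          ‖(τ : ℂ) • (χ.withDatum δ).dat Φ A + (χ.withDatum δ).lin B'‖ < (χ.withDatum δ).a := by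
  intro Φ A τ B' hΦ hA hτ0 hτ1 hB'
  have hB'' : ‖B'‖ < χ.α₃ := hB'
  set X : ℝ := ‖δ.Q‖ * (χ.idx.η * (2 * (χ.α₂ + α'))) with hX
  have hdat : ‖(χ.withDatum δ).dat Φ A‖ ≤ ‖χ.lin‖ * X + ρ :=
    χ.norm_dat_withDatum_le_of_region δ hη h0 R Φ A hA (hh Φ hΦ) hsmall (hfar Φ hΦ A hA)
  have hlin0 : 0 ≤ ‖χ.lin‖ := χ.lin.opNorm_nonneg
  have h1 : ‖(τ : ℂ) • (χ.withDatum δ).dat Φ A‖ ≤ ‖χ.lin‖ * X + ρ := by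
    rw [norm_smul, Complex.norm_real, Real.norm_of_nonneg hτ0]
    calc τ * ‖(χ.withDatum δ).dat Φ A‖ ≤ 1 * ‖(χ.withDatum δ).dat Φ A‖ := by gcongr
      _ = ‖(χ.withDatum δ).dat Φ A‖ := one_mul _
      _ ≤ ‖χ.lin‖ * X + ρ := hdat
  have h2 : ‖(χ.withDatum δ).lin B'‖ ≤ ‖χ.lin‖ * χ.α₃ := by
    rw [withDatum_lin]
    exact (χ.lin.le_opNorm B').trans (mul_le_mul_of_nonneg_left hB''.le hlin0)
  calc ‖(τ : ℂ) • (χ.withDatum δ).dat Φ A + (χ.withDatum δ).lin B'‖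
      ≤ ‖(τ : ℂ) • (χ.withDatum δ).dat Φ A‖ + ‖(χ.withDatum δ).lin B'‖ := norm_add_le _ _
    _ ≤ (‖χ.lin‖ * X + ρ) + ‖χ.lin‖ * χ.α₃ := add_le_add h1 h2
    _ = ‖χ.lin‖ * (X + χ.α₃) + ρ := by ring
    _ < χ.a := ha'

/-- **THE CHART LAWS OF MODULE D AT A PRESENTED RUN, IN TWO REGIONS** = the run's thirteen datum-free laws (module E's binders, verbatim) + the (3.27)-type law ON `R` +
the far remainder + the constant arithmetic; the two datum sizes are `dat_lt_withDatum_of_region ∕ dat_lin_lt_withDatum_of_region`.  Hence module D's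
`ChartB12Inputs.toFundamental ∕ leaf_of_chart ∕ package_of_chart` and module E's `provisos_of_chart_withDatum` apply BY NAME.  BY REFERENCE (nothing of [15] is proved).
[cite: Balaban1987RG1, (3.27) p.275, (3.30)–(3.32) pp.276–277, (3.37) p.277, (3.45) p.279, (3.50) pp.279–280] [cite: Balaban1985Variational, Prop. 6 p.295, (176)–(177) p.306, Prop. 9 p.309] -/
theorem chartB12Laws_withDatum_of_region {Rz : Sect2.Residual P (MatA N)} {cB α' ρ : ℝ}
    (regime : Regime χ.𝒢 0 χ.W χ.B₀ χ.θ χ.C₄ χ.a₃ χ.jc χ.a χ.ε₄) (jc_nonneg : 0 ≤ χ.jc) (T_zero : χ.T 0 = 0) (Klip_pos : 0 < χ.Klip)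
    (lip : ∀ x y : 𝒴, ‖x‖ < χ.ε₄ + χ.a → ‖y‖ < χ.ε₄ + χ.a → ‖χ.T x - χ.T y‖ ≤ χ.Klip * ‖x - y‖) (KD_nonneg : 0 ≤ χ.K_D)
    (second : ∀ Y : 𝒴, ‖Y‖ < χ.ε₄ + χ.a → ‖χ.T Y - Y‖ ≤ χ.K_D * ‖Y‖ ^ 2)
    (ev_le : ∀ (Y : 𝒴) (b : PBond P 0), ‖χ.ev Y b‖ ≤ ‖Y‖)
    (grad_ev_le : ∀ (Y : 𝒴) (μ ν : Fin P.d) (y : Site P 0), ‖grad (χ.toResid.csX cB).ξ μ (fun z => χ.ev Y ⟨z, ν⟩) y‖ ≤ ‖Y‖)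
    (ev_gc : ∀ (Y : 𝒴) (b : PBond P 0), χ.ev Y b ∈ (suModel N).gc)
    (h337 : χ.Klip * (χ.ε₄ + χ.a) ≤ χ.toResid.consts.B₃ ^ 2 * χ.toResid.consts.O₁ * χ.toResid.consts.M * χ.toResid.consts.α₀ *
      (χ.toResid.consts.L ^ (χ.toResid.idx.j - 1) * χ.toResid.idx.η))
    (h345 : 2 * (χ.K_D + χ.B₀ * χ.C₄) * (χ.ε₄ + χ.a) ^ 2 < χ.toResid.consts.B₃ *
      (χ.toResid.consts.B₃ * χ.toResid.consts.O₁ * χ.toResid.consts.M * χ.toResid.consts.α₀ * (χ.toResid.consts.L ^ (χ.toResid.idx.j - 1) * χ.toResid.idx.η)) ^ 2)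
    (h350 : χ.Klip * ((χ.θ + 4 * χ.B₀ * χ.C₄ * (χ.ε₄ + χ.a)) / (1 - (χ.θ + 4 * χ.B₀ * χ.C₄ * (χ.ε₄ + χ.a))) + 1) * ‖χ.lin‖ ≤ χ.toResid.consts.B₃)
    (hη : 0 < χ.idx.η) (h0 : 0 ≤ χ.α₂ + α') (R : Set (PBond P 0))
    (hh : ∀ Φ : FieldPair P 0 (MatA N)ˣ (MatA N),
      Φ ∈ space (suModel N) (χ.toResid.frameBox Rz) (χ.toResid.csBox cB) ((1 + 2 * χ.toResid.consts.β) * χ.toResid.consts.α₀)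
          ((1 + 2 * χ.toResid.consts.β) * χ.toResid.consts.α₁) χ.toResid.α₀ →
        ∀ b ∈ R, ‖δ.hBox Φ b‖ < α')
    (hfar : ∀ Φ : FieldPair P 0 (MatA N)ˣ (MatA N),
      Φ ∈ space (suModel N) (χ.toResid.frameBox Rz) (χ.toResid.csBox cB) ((1 + 2 * χ.toResid.consts.β) * χ.toResid.consts.α₀)
          ((1 + 2 * χ.toResid.consts.β) * χ.toResid.consts.α₁) χ.toResid.α₀ →
        ∀ A : PBond P 0 → MatA N, A ∈ A331Of N χ.idx χ.α₂ χ.β₀ → ‖χ.datFar δ R Φ A‖ ≤ ρ)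
    (hsmall : χ.idx.η * (χ.α₂ + α') ≤ 1 / 8) (ha : ‖χ.lin‖ * (‖δ.Q‖ * (χ.idx.η * (2 * (χ.α₂ + α')))) + ρ < χ.a)
    (ha' : ‖χ.lin‖ * (‖δ.Q‖ * (χ.idx.η * (2 * (χ.α₂ + α'))) + χ.α₃) + ρ < χ.a) :
    ChartB12Laws Rz cB (χ.withDatum δ) :=
  ⟨regime, jc_nonneg, T_zero, Klip_pos, lip, KD_nonneg, second, ev_le, grad_ev_le, ev_gc,
    χ.dat_lt_withDatum_of_region δ hη h0 R hh hfar hsmall ha, χ.dat_lin_lt_withDatum_of_region δ hη h0 R hh hfar hsmall ha', h337, h345, h350⟩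

/-- **THE CHART LAWS AT A PRESENTED RUN WITH (3.27) READ «on □̃⁴» AS PRINTED**: `R :=` the bonds of `□̃⁴ = regionT 4` — the law `|h(𝐔)(b)| < α′` is asked exactly on the
bonds of `□̃⁴` (print's `α′ = B₃O(1)Mα₀`), and the contribution of `A|_{□₀∖□̃⁴}` to `𝔄` is the displayed remainder `‖𝔄_far‖ ≤ ρ` (located readings (R-F1), (R-F2)).
[cite: Balaban1987RG1, (3.27) p.275 («on □̃⁴»), p.276 («□₀ by □̃⁴, see (3.27)»), (3.32) p.277 («on □̃⁴»), p.277 («|B| < O(1)L^jη»)] -/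
theorem chartB12Laws_withDatum_box4 {Rz : Sect2.Residual P (MatA N)} {cB α' ρ : ℝ}
    (regime : Regime χ.𝒢 0 χ.W χ.B₀ χ.θ χ.C₄ χ.a₃ χ.jc χ.a χ.ε₄) (jc_nonneg : 0 ≤ χ.jc) (T_zero : χ.T 0 = 0) (Klip_pos : 0 < χ.Klip)
    (lip : ∀ x y : 𝒴, ‖x‖ < χ.ε₄ + χ.a → ‖y‖ < χ.ε₄ + χ.a → ‖χ.T x - χ.T y‖ ≤ χ.Klip * ‖x - y‖) (KD_nonneg : 0 ≤ χ.K_D)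
    (second : ∀ Y : 𝒴, ‖Y‖ < χ.ε₄ + χ.a → ‖χ.T Y - Y‖ ≤ χ.K_D * ‖Y‖ ^ 2)
    (ev_le : ∀ (Y : 𝒴) (b : PBond P 0), ‖χ.ev Y b‖ ≤ ‖Y‖)
    (grad_ev_le : ∀ (Y : 𝒴) (μ ν : Fin P.d) (y : Site P 0), ‖grad (χ.toResid.csX cB).ξ μ (fun z => χ.ev Y ⟨z, ν⟩) y‖ ≤ ‖Y‖)
    (ev_gc : ∀ (Y : 𝒴) (b : PBond P 0), χ.ev Y b ∈ (suModel N).gc)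
    (h337 : χ.Klip * (χ.ε₄ + χ.a) ≤ χ.toResid.consts.B₃ ^ 2 * χ.toResid.consts.O₁ * χ.toResid.consts.M * χ.toResid.consts.α₀ *
      (χ.toResid.consts.L ^ (χ.toResid.idx.j - 1) * χ.toResid.idx.η))
    (h345 : 2 * (χ.K_D + χ.B₀ * χ.C₄) * (χ.ε₄ + χ.a) ^ 2 < χ.toResid.consts.B₃ *
      (χ.toResid.consts.B₃ * χ.toResid.consts.O₁ * χ.toResid.consts.M * χ.toResid.consts.α₀ * (χ.toResid.consts.L ^ (χ.toResid.idx.j - 1) * χ.toResid.idx.η)) ^ 2)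
    (h350 : χ.Klip * ((χ.θ + 4 * χ.B₀ * χ.C₄ * (χ.ε₄ + χ.a)) / (1 - (χ.θ + 4 * χ.B₀ * χ.C₄ * (χ.ε₄ + χ.a))) + 1) * ‖χ.lin‖ ≤ χ.toResid.consts.B₃)
    (hη : 0 < χ.idx.η) (h0 : 0 ≤ χ.α₂ + α')
    (hh : ∀ Φ : FieldPair P 0 (MatA N)ˣ (MatA N),
      Φ ∈ space (suModel N) (χ.toResid.frameBox Rz) (χ.toResid.csBox cB) ((1 + 2 * χ.toResid.consts.β) * χ.toResid.consts.α₀)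
          ((1 + 2 * χ.toResid.consts.β) * χ.toResid.consts.α₁) χ.toResid.α₀ →
        ∀ b ∈ (χ.idx.regionT 4).bonds, ‖δ.hBox Φ b‖ < α')
    (hfar : ∀ Φ : FieldPair P 0 (MatA N)ˣ (MatA N),
      Φ ∈ space (suModel N) (χ.toResid.frameBox Rz) (χ.toResid.csBox cB) ((1 + 2 * χ.toResid.consts.β) * χ.toResid.consts.α₀)
          ((1 + 2 * χ.toResid.consts.β) * χ.toResid.consts.α₁) χ.toResid.α₀ →
        ∀ A : PBond P 0 → MatA N, A ∈ A331Of N χ.idx χ.α₂ χ.β₀ → ‖χ.datFar δ (χ.idx.regionT 4).bonds Φ A‖ ≤ ρ)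
    (hsmall : χ.idx.η * (χ.α₂ + α') ≤ 1 / 8) (ha : ‖χ.lin‖ * (‖δ.Q‖ * (χ.idx.η * (2 * (χ.α₂ + α')))) + ρ < χ.a)
    (ha' : ‖χ.lin‖ * (‖δ.Q‖ * (χ.idx.η * (2 * (χ.α₂ + α'))) + χ.α₃) + ρ < χ.a) :
    ChartB12Laws Rz cB (χ.withDatum δ) :=
  χ.chartB12Laws_withDatum_of_region δ regime jc_nonneg T_zero Klip_pos lip KD_nonneg second ev_le grad_ev_le ev_gc h337 h345 h350 hη h0
    (χ.idx.regionT 4).bonds hh hfar hsmall ha ha'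

end ChartB12Run

end WithDatumRegion

end Literature.MathematicalPhysics.QuantumFieldTheory.Balaban1983to89.Node00
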